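import Mathlib.LinearAlgebra.Matrix.Block
import Mathlib.LinearAlgebra.Matrix.Reindex
import Mathlib.LinearAlgebra.Matrix.NonsingularInverse
import Mathlib.LinearAlgebra.Matrix.Trace
import Mathlib.LinearAlgebra.Matrix.ToLin
import Mathlib.LinearAlgebra.Projection
import Mathlib.LinearAlgebra.FiniteDimensional.Lemmas
import Mathlib.RingTheory.Localization.AtPrime.Basic
import Mathlib.RingTheory.Localization.Ideal
import Mathlib.RingTheory.MvPolynomial.Homogeneous
import Mathlib.Algebra.MvPolynomial.Eval
import Literature.AlgebraicGeometry.DeterminantalHypersurfaces.KernerVinnikovDecomposability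
import HarnessLib

/-!
# Kerner–Vinnikov decomposability: linear-algebra preliminaries (proofs)

Support lemmas for the proof of `KernerVinnikov2012_globallyDecomposable_iff`
(`KernerVinnikovDecomposability.lean`; D. Kerner, V. Vinnikov, Adv. Math. 231 (2012),
arXiv:0906.3012, §3 Thm. 3.1):

* `exists_conj_eq_fromBlocks_of_idempotent`: an idempotent matrix over a field is conjugate to
  `𝟙_q ⊕ 0` (Part 2 of the printed proof: "the multiplication `ℳ ↦ U₁ ℳ U₂` … can bring the
  collections `{A_α}`, `{B_α}` to the block-diagonal form"), with `q = tr A` recorded so that the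
  ranks of the row- and column-projectors can be matched through `tr(ℳ𝒩₁) = tr(𝒩₁ℳ)`;
* `exists_mul_adjugate_mem_span_pair_of_local`: the local half of Part 1 — if over the local ring
  `𝒪_a` the matrix `M` is equivalent to `𝟙 ⊕ N₁ ⊕ N₂` with `det N_α ∈ (f_α)`, then every entry of
  `adj M` lies in `(f₁, f₂) 𝒪_a`, i.e. `s · (adj M)_{ij} ∈ (f₁, f₂)` for some `s` with `s(a) ≠ 0`
  ("the local ideal generated by the entries of `ℳ^∨` is invariant under local equivalence").

## References

* [KernerVinnikov2012] D. Kerner, V. Vinnikov, Adv. Math. 231 (2012) 1619–1654, §3.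
-/

noncomputable section

open Matrix

namespace Literature.AlgebraicGeometry.DeterminantalHypersurfaces

/-! ## Idempotent matrices are conjugate to `𝟙 ⊕ 0` -/

section idempotent

variable {k : Type*} [Field k]

/-- An idempotent `d × d` matrix `A` over a field is conjugate to the block matrix `𝟙_q ⊕ 0_{q'}`
(`q + q' = d`, blocks placed along `Fin q ⊕ Fin q' ≃ Fin d`), and `q = tr A`. [folklore] -/
theorem exists_conj_eq_fromBlocks_of_idempotent {d : ℕ} (A : Matrix (Fin d) (Fin d) k)
    (hA : A * A = A) :
    ∃ (q q' : ℕ) (h : q + q' = d) (P : Matrix (Fin d) (Fin d) k), IsUnit P ∧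
      P⁻¹ * A * P = Matrix.reindex (finSumFinEquiv.trans (finCongr h))
        (finSumFinEquiv.trans (finCongr h)) (Matrix.fromBlocks 1 0 0 0 :
          Matrix (Fin q ⊕ Fin q') (Fin q ⊕ Fin q') k) ∧
      (q : k) = A.trace := by
  classical
  set T : (Fin d → k) →ₗ[k] (Fin d → k) := Matrix.toLin' A with hT
  have hTT : ∀ v, T (T v) = T v := fun v => by
    have : T ∘ₗ T = T := by rw [hT, ← Matrix.toLin'_mul, hA]
    exact LinearMap.congr_fun this v
  have hproj : LinearMap.IsProj (LinearMap.range T) T :=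
    ⟨fun x => LinearMap.mem_range_self T x, fun x ⟨y, hy⟩ => by rw [← hy, hTT]⟩
  have hcompl : IsCompl (LinearMap.range T) (LinearMap.ker T) := hproj.isCompl
  set q := Module.finrank k (LinearMap.range T) with hq
  set q' := Module.finrank k (LinearMap.ker T) with hq'
  have hqq' : q + q' = d := by
    rw [hq, hq', LinearMap.finrank_range_add_finrank_ker, Module.finrank_fin_fun]
  -- a basis adapted to `range T ⊕ ker T`
  let b : Module.Basis (Fin q ⊕ Fin q') k (Fin d → k) :=
    ((Module.finBasis k (LinearMap.range T)).prod (Module.finBasis k (LinearMap.ker T))).map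
      (Submodule.prodEquivOfIsCompl _ _ hcompl)
  have hb_inl : ∀ x, T (b (Sum.inl x)) = b (Sum.inl x) := by
    intro x
    have hmem : b (Sum.inl x) ∈ LinearMap.range T := by
      simp [b, Submodule.coe_prodEquivOfIsCompl']
    obtain ⟨y, hy⟩ := hmem
    rw [← hy, hTT]
  have hb_inr : ∀ y, T (b (Sum.inr y)) = 0 := by
    intro y
    have hmem : b (Sum.inr y) ∈ LinearMap.ker T := by
      simp [b, Submodule.coe_prodEquivOfIsCompl']
    exact LinearMap.mem_ker.mp hmem
  -- the matrices of basis vectors (columns) and the coordinate functionals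
  set ε : Fin q ⊕ Fin q' ≃ Fin d := finSumFinEquiv.trans (finCongr hqq') with hε
  set P₀ : Matrix (Fin d) (Fin q ⊕ Fin q') k := Matrix.of fun i x => b x i with hP₀
  set Q₀ : Matrix (Fin q ⊕ Fin q') (Fin d) k :=
    Matrix.of fun x i => b.repr (Pi.single i 1) x with hQ₀
  set F : Matrix (Fin q ⊕ Fin q') (Fin q ⊕ Fin q') k := Matrix.fromBlocks 1 0 0 0 with hF
  have hPQ : P₀ * Q₀ = 1 := by
    ext i i'
    have := congrFun (b.sum_repr (Pi.single i' (1 : k))) i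
    simp only [Finset.sum_apply, Pi.smul_apply, smul_eq_mul] at this
    rw [Matrix.mul_apply, Matrix.one_apply]
    simp only [hP₀, hQ₀, Matrix.of_apply]
    rw [show (∑ x, b x i * (b.repr (Pi.single i' 1)) x) = ∑ x, (b.repr (Pi.single i' 1)) x * b x i
      from Finset.sum_congr rfl fun x _ => mul_comm _ _, this, Pi.single_apply]
  have hAP : A * P₀ = P₀ * F := by
    ext i x
    have h1 : (A * P₀) i x = T (b x) i := by
      rw [hT, Matrix.toLin'_apply, Matrix.mulVec, Matrix.mul_apply]
      rfl
    rw [h1, Matrix.mul_apply, Fintype.sum_sum_type]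
    cases x with
    | inl x₁ =>
      rw [hb_inl]
      simp [hP₀, hF, Matrix.one_apply]
    | inr x₂ =>
      rw [hb_inr]
      simp [hF]
  set P : Matrix (Fin d) (Fin d) k := P₀.submatrix id ε.symm with hP
  have hPunit : IsUnit P := by
    refine IsUnit.of_mul_eq_one (Q₀.submatrix ε.symm id) ?_
    rw [hP, Matrix.submatrix_mul_equiv (e₁ := (id : Fin d → Fin d)) P₀ Q₀ ε.symm id, hPQ]
    simp
  have hdet : IsUnit P.det := (Matrix.isUnit_iff_isUnit_det _).mp hPunit
  have hAP' : A * P = P * Matrix.reindex ε ε F := by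
    rw [hP, Matrix.reindex_apply, Matrix.submatrix_mul_equiv P₀ F id ε.symm ε.symm, ← hAP,
      Matrix.submatrix_mul A P₀ id id ε.symm Function.bijective_id, Matrix.submatrix_id_id]
  refine ⟨q, q', hqq', P, hPunit, ?_, ?_⟩
  · rw [Matrix.mul_assoc, hAP', ← Matrix.mul_assoc, Matrix.nonsing_inv_mul _ hdet, Matrix.one_mul]
  · -- `tr A = tr F = q`
    have htrF : F.trace = q := by
      rw [Matrix.trace, hF]
      simp [Fintype.sum_sum_type]
    have hA' : A = P * Matrix.reindex ε ε F * P⁻¹ := by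
      rw [← hAP', Matrix.mul_assoc, Matrix.mul_nonsing_inv _ hdet, Matrix.mul_one]
    rw [hA', Matrix.trace_mul_cycle, Matrix.nonsing_inv_mul _ hdet, Matrix.one_mul, ← htrF,
      Matrix.reindex_apply, Matrix.trace, Matrix.trace]
    simp only [Matrix.diag_apply, Matrix.submatrix_apply]
    exact (Equiv.sum_comp ε.symm (fun x => F x x)).symm

end idempotent

/-! ## The local computation: entries of `adj M` lie in `(f₁, f₂)` locally -/

section localAdjugate

open MvPolynomial

variable {k : Type*} [Field k] {n : ℕ}

/-- **Local half of Part 1 of [KernerVinnikov2012, Thm. 3.1].** If over `𝒪_a = k[x]_{ker (eval a)}`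
the matrix `M` is equivalent to `𝟙_r ⊕ N₁ ⊕ N₂` with `det N_α = (unit) · f_α`, then every entry of
`adj M` lies in `(f₁, f₂) 𝒪_a`: there is `s` with `s(a) ≠ 0` and `s · (adj M)_{ij} ∈ (f₁, f₂)`.
("The local ideal generated by the entries of `ℳ^∨` is invariant under local equivalence"; here
`adj (𝟙 ⊕ N₁ ⊕ N₂) = det N₁ det N₂ 𝟙 ⊕ det N₂ adj N₁ ⊕ det N₁ adj N₂`.)
[cite: KernerVinnikov2012, §3, proof of Thm. 3.1, Part 1] -/
theorem exists_mul_adjugate_mem_span_pair_of_local {d r e₁ e₂ : ℕ} (h : r + e₁ + e₂ = d)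
    (f₁ f₂ : MvPolynomial (Fin n) k) (hf : f₁ * f₂ ≠ 0)
    (M : Matrix (Fin d) (Fin d) (MvPolynomial (Fin n) k)) (a : Fin n → k)
    [(RingHom.ker (MvPolynomial.eval a)).IsPrime]
    (A B : Matrix (Fin d) (Fin d) (Localization.AtPrime (RingHom.ker (MvPolynomial.eval a))))
    (N₁ : Matrix (Fin e₁) (Fin e₁) (Localization.AtPrime (RingHom.ker (MvPolynomial.eval a))))
    (N₂ : Matrix (Fin e₂) (Fin e₂) (Localization.AtPrime (RingHom.ker (MvPolynomial.eval a))))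
    (u₁ u₂ : (Localization.AtPrime (RingHom.ker (MvPolynomial.eval a)))ˣ)
    (hA : IsUnit A) (hB : IsUnit B)
    (hABM : A * M.map (algebraMap (MvPolynomial (Fin n) k)
        (Localization.AtPrime (RingHom.ker (MvPolynomial.eval a)))) * B =
      (Matrix.fromBlocks (1 : Matrix (Fin r) (Fin r) _) 0 0 (Matrix.fromBlocks N₁ 0 0 N₂)).reindex
        (blockIndexEquiv h) (blockIndexEquiv h))
    (hN₁ : N₁.det = (u₁ : Localization.AtPrime (RingHom.ker (MvPolynomial.eval a))) *
      algebraMap (MvPolynomial (Fin n) k) _ f₁)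
    (hN₂ : N₂.det = (u₂ : Localization.AtPrime (RingHom.ker (MvPolynomial.eval a))) *
      algebraMap (MvPolynomial (Fin n) k) _ f₂)
    (i j : Fin d) :
    ∃ s : MvPolynomial (Fin n) k, eval a s ≠ 0 ∧ s * M.adjugate i j ∈ Ideal.span {f₁, f₂} := by
  set P : Ideal (MvPolynomial (Fin n) k) := RingHom.ker (MvPolynomial.eval a) with hP
  set φ := algebraMap (MvPolynomial (Fin n) k) (Localization.AtPrime P) with hφ
  set I : Ideal (MvPolynomial (Fin n) k) := Ideal.span {f₁, f₂} with hI
  set J : Ideal (Localization.AtPrime P) := I.map φ with hJ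
  have hφinj : Function.Injective φ :=
    IsLocalization.injective (Localization.AtPrime P) P.primeCompl_le_nonZeroDivisors
  have hf₁J : φ f₁ ∈ J := Ideal.mem_map_of_mem φ (Ideal.subset_span (by simp))
  have hf₂J : φ f₂ ∈ J := Ideal.mem_map_of_mem φ (Ideal.subset_span (by simp))
  have hN₁J : N₁.det ∈ J := by rw [hN₁]; exact J.mul_mem_left _ hf₁J
  have hN₂J : N₂.det ∈ J := by rw [hN₂]; exact J.mul_mem_left _ hf₂J
  -- the block matrix `D₀ = 𝟙 ⊕ N₁ ⊕ N₂` and its adjugate `D₀'`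
  set D₀ : Matrix (Fin r ⊕ (Fin e₁ ⊕ Fin e₂)) (Fin r ⊕ (Fin e₁ ⊕ Fin e₂))
      (Localization.AtPrime P) := fromBlocks 1 0 0 (fromBlocks N₁ 0 0 N₂) with hD₀
  set D₀' : Matrix (Fin r ⊕ (Fin e₁ ⊕ Fin e₂)) (Fin r ⊕ (Fin e₁ ⊕ Fin e₂))
      (Localization.AtPrime P) :=
    fromBlocks ((N₁.det * N₂.det) • (1 : Matrix (Fin r) (Fin r) _)) 0 0
      (fromBlocks (N₂.det • N₁.adjugate) 0 0 (N₁.det • N₂.adjugate)) with hD₀'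
  have hdetD₀ : D₀.det = N₁.det * N₂.det := by
    rw [hD₀, det_fromBlocks_zero₂₁, det_one, one_mul, det_fromBlocks_zero₂₁]
  have hDD' : D₀ * D₀' = D₀.det • (1 : Matrix _ _ (Localization.AtPrime P)) := by
    rw [hdetD₀, hD₀, hD₀', fromBlocks_multiply, ← fromBlocks_one, fromBlocks_smul,
      fromBlocks_multiply, ← fromBlocks_one, fromBlocks_smul]
    simp only [Matrix.one_mul, Matrix.zero_mul, Matrix.mul_zero, add_zero, zero_add, smul_zero,
      Matrix.mul_smul, mul_adjugate, smul_smul]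
    congr 2
    rw [mul_comm]
  have hdet0 : D₀.det ≠ 0 := by
    rw [hdetD₀, hN₁, hN₂]
    have : φ (f₁ * f₂) ≠ 0 := (map_ne_zero_iff φ hφinj).mpr hf
    rw [map_mul] at this
    rw [show (u₁ : Localization.AtPrime P) * φ f₁ * ((u₂ : Localization.AtPrime P) * φ f₂) =
      ((u₁ * u₂ : (Localization.AtPrime P)ˣ) : Localization.AtPrime P) * (φ f₁ * φ f₂) by
      push_cast; ring]
    exact mul_ne_zero (Units.ne_zero _) this
  have hadjD₀ : D₀.adjugate = D₀' := by
    have h1 : D₀.det • D₀.adjugate = D₀.det • D₀' := by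
      calc D₀.det • D₀.adjugate = D₀.adjugate * (D₀.det • (1 : Matrix _ _ _)) := by
            rw [Matrix.mul_smul, Matrix.mul_one]
        _ = D₀.adjugate * (D₀ * D₀') := by rw [hDD']
        _ = (D₀.adjugate * D₀) * D₀' := by rw [Matrix.mul_assoc]
        _ = D₀.det • D₀' := by rw [adjugate_mul, Matrix.smul_mul, Matrix.one_mul]
    ext x y
    have := congrFun (congrFun h1 x) y
    simp only [Matrix.smul_apply, smul_eq_mul] at this
    exact mul_left_cancel₀ hdet0 this
  -- all entries of `D₀'` lie in `J`
  have hD₀'J : ∀ x y, D₀' x y ∈ J := by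
    have hc : N₁.det * N₂.det ∈ J := J.mul_mem_right _ hN₁J
    intro x y
    rcases x with x | x | x <;> rcases y with y | y | y <;>
      simp only [hD₀', fromBlocks_apply₁₁, fromBlocks_apply₁₂, fromBlocks_apply₂₁,
        fromBlocks_apply₂₂, Matrix.zero_apply, Matrix.smul_apply, smul_eq_mul]
    · exact J.mul_mem_right _ hc
    · exact J.zero_mem
    · exact J.zero_mem
    · exact J.zero_mem
    · exact J.mul_mem_right _ hN₂J
    · exact J.zero_mem
    · exact J.zero_mem
    · exact J.zero_mem
    · exact J.mul_mem_right _ hN₁J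
  -- `M = A⁻¹ D B⁻¹` over `𝒪_a`, hence `adj M = adj B⁻¹ · adj D · adj A⁻¹` has entries in `J`
  have hAdet : IsUnit A.det := (Matrix.isUnit_iff_isUnit_det _).mp hA
  have hBdet : IsUnit B.det := (Matrix.isUnit_iff_isUnit_det _).mp hB
  have hM : M.map φ = A⁻¹ * Matrix.reindex (blockIndexEquiv h) (blockIndexEquiv h) D₀ * B⁻¹ := by
    rw [← hABM]
    rw [Matrix.mul_assoc, Matrix.mul_assoc, Matrix.mul_nonsing_inv _ hBdet, Matrix.mul_one,
      ← Matrix.mul_assoc, Matrix.nonsing_inv_mul _ hAdet, Matrix.one_mul]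
  have key : ∀ x y, (M.map φ).adjugate x y ∈ J := by
    intro x y
    rw [hM, adjugate_mul_distrib, adjugate_mul_distrib, adjugate_reindex, hadjD₀, Matrix.mul_apply]
    refine J.sum_mem fun l _ => J.mul_mem_left _ ?_
    rw [Matrix.mul_apply]
    refine J.sum_mem fun l' _ => J.mul_mem_right _ ?_
    simp only [reindex_apply, submatrix_apply]
    exact hD₀'J _ _
  have hmap : (M.map φ).adjugate i j = φ (M.adjugate i j) := by
    have := RingHom.map_adjugate φ M
    rw [RingHom.mapMatrix_apply, RingHom.mapMatrix_apply] at this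
    rw [← this, Matrix.map_apply]
  have hij := key i j
  rw [hmap] at hij
  obtain ⟨s, hs, hsI⟩ :=
    (IsLocalization.algebraMap_mem_map_algebraMap_iff P.primeCompl (S := Localization.AtPrime P)
      I _).mp hij
  exact ⟨s, hs, hsI⟩

end localAdjugate

end Literature.AlgebraicGeometry.DeterminantalHypersurfaces
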